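import Literature.Computability.Cryptography.Sweep1Proofs
import Literature.Computability.Cryptography.ImpagliazzoLevinInverter
import HarnessLib

/-!
# crypto-foundations.S25, discharged: one-way functions imply `DistNP ⊄ HeurBPP`

D-0014 companion of `Sweep1.lean` (and of `Sweep1Proofs.lean`) closing the named fact
`Literature.Computability.Cryptography.DistNP_not_subset_HeurBPP_of_OWFExist`
(crypto-foundations.S25, `DistNP` form) unconditionally.

* The uniform-ensemble form `OWF ⇒ (NP, U) ⊄ HeurBPP`
  (`distClass_NP_uniform_not_subset_HeurBPP_of_OWFExist`) is the contrapositive of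
  Bogdanov–Trevisan's theorem "if `(NP, U) ⊆ HeurBPP` then every polynomial-time computable family
  `fₙ` is inverted on a `1 - δ` fraction of `x ∼ Uₙ`, hence there are no one-way functions"
  (Found. Trends TCS 2 (2006), §4.3; Thm. 27, body p. 33, in the sequential numbering of
  arXiv:cs/0606037v2 = Thm. 22, §3.3 of ECCC TR06-073, whose chapter order differs; Thm. 28 in the
  2021 revision arXiv v3). It is proved in the tree by the Impagliazzo–Levin development
  `ImpagliazzoLevin{Hashing,OWF,Verifier,Round,Analysis,Inverter}.lean`, which follows the survey's
  second proof (§5.1: Valiant–Vazirani isolation by pairwise-independent affine hashing, the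
  domination bound of Thm. 29 with Claim 28, majority-vote amplification of the heuristic scheme,
  and the two machine constructions "the verifier relation of `L_f` is in `P`" and "the inverter
  is PPT") and ends in the closed term `ImpagliazzoLevin.OWFExist_imp_not_subset_HeurBPP`, whose
  type is literally that fact.
* `DistNP_not_subset_HeurBPP_of_OWFExist_holds` — `OWF ⇒ DistNP ⊄ HeurBPP`, in print the closing
  remark of §5.1.3 (arXiv v2 body p. 42, after Cor. 30: inverting a supposed one-way function on
  `fₙ(Uₙ)` is a problem of `(NP, PSamp)`, "therefore, if `(BH, U^BH)` has a heuristic scheme, then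
  no one-way functions exist"), restated by the authors in §8.2 (arXiv v2 p. 69: "… one-way
  functions exist (and in particular `(NP, PSamp) ⊄ HeurBPP`)"). The tree derives it from the
  uniform form along `(NP, U) ⊆ (NP, PSamp) = DistNP` (the uniform ensemble is samplable,
  `uniformEnsemble_mem_PSamp_holds`, B–T §2.1): the glue `DistNP_not_subset_HeurBPP_of_OWFExist_of`
  is proved in `Sweep1Proofs.lean`, so the discharge is that glue applied to the proved uniform
  form.

This is a separate leaf module rather than an appendix to `Sweep1Proofs.lean` on purpose:
`Sweep1Proofs.lean` heads the Liu–Pass / Goldreich–Levin import chain (`LiuPassWeakOWF.lean` and its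
≈ 50 transitive importers), and importing the Impagliazzo–Levin development there would add its
≈ 90-module closure (stack-machine bricks, Valiant–Vazirani, counting) to all of them; nothing needs
to import the present file.

Locators were checked against the arXiv v2 PDF and the ECCC TR06-073 PDF (text of Thm. 27 / Thm. 22,
Cor. 30, the §5.1.3 closing remark, the §8.2 remark) and against the arXiv v3 TeX source.

## References

* A. Bogdanov, L. Trevisan, *Average-Case Complexity*, Found. Trends Theor. Comput. Sci. 2 (2006),
  no. 1, 1–106, doi:10.1561/0400000004; arXiv:cs/0606037; ECCC TR06-073: §4.3 (arXiv v2 Thm. 27 =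
  ECCC Thm. 22: `(NP, U) ⊆ HeurBPP ⇒` no one-way functions), §5.1 (Claim 28, Thm. 29, Cor. 30 and the
  closing remark of §5.1.3), §8.2 (remark on p. 69 of arXiv v2), §2.1 (the uniform and the samplable
  ensembles), §2.3 (`HeurBPP`).
* R. Impagliazzo, L. Levin, *No better ways to generate hard NP instances than picking uniformly at
  random*, FOCS 1990, §4.
* S. Ben-David, B. Chor, O. Goldreich, M. Luby, *On the theory of average case complexity*,
  JCSS 44 (1992).
-/

namespace Literature.Computability.Cryptography

/-- **Discharge of `DistNP_not_subset_HeurBPP_of_OWFExist`** (crypto-foundations.S25, `DistNP`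
form): if one-way functions exist then `DistNP ⊄ HeurBPP`. In print: the closing remark of
Bogdanov–Trevisan §5.1.3 (arXiv:cs/0606037v2 p. 42, after Cor. 30, `(BH, U^BH) ∈ HeurBPP ⇒
(NP, PSamp) ⊆ HeurBPP`: "an important example of a problem in `(NP, PSamp)` is the problem of
inverting a supposed one-way function `fₙ` … therefore, if `(BH, U^BH)` has a heuristic scheme,
then no one-way functions exist"), and again §8.2 (p. 69: "one-way functions exist (and in
particular `(NP, PSamp) ⊄ HeurBPP`)"). Proof: the uniform-ensemble form `OWF ⇒ (NP, U) ⊄ HeurBPP`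
(§4.3, arXiv v2 Thm. 27 = ECCC TR06-073 Thm. 22), proved in the tree as
`ImpagliazzoLevin.OWFExist_imp_not_subset_HeurBPP` (the survey's second proof, §5.1), along
`(NP, U) ⊆ (NP, PSamp) = DistNP`, the uniform ensemble being polynomial-time samplable (§2.1;
`uniformEnsemble_mem_PSamp_holds`) — the glue `DistNP_not_subset_HeurBPP_of_OWFExist_of` of
`Sweep1Proofs.lean`. [A. Bogdanov, L. Trevisan, Found. Trends TCS 2 (2006), §5.1.3 (closing
remark, with Cor. 30) and §4.3 (arXiv:cs/0606037v2 Thm. 27); §8.2; R. Impagliazzo, L. Levin,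
FOCS 1990, §4]
[cite: BogdanovTrevisan2006, §5.1.3 closing remark with Cor. 30; §4.3 Thm. 27 (arXiv:cs/0606037v2 numbering)] -/
theorem DistNP_not_subset_HeurBPP_of_OWFExist_holds : DistNP_not_subset_HeurBPP_of_OWFExist :=
  DistNP_not_subset_HeurBPP_of_OWFExist_of ImpagliazzoLevin.OWFExist_imp_not_subset_HeurBPP

end Literature.Computability.Cryptography
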